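import Summits.ABC.IUTFork.Joshi.LocalPeriodRingsSplitting
import HarnessLib

/-!
# [J-III] §5.2.5 (5.2.5.5) / §7.5.2 (7.5.2.2) «`B_E ↪ B̃_E = B ⊗_{ℚ_p} E`» — DERIVED from Lemma 5.2.3.1 ALONE, as the
# canonical section of the multiplication map `B̃_E ↠ B_E` (separability idempotent of `E_0/ℚ_p`); no (5.2.5.4) witness

Block E (rung LADDER-ABC:A2.E) of the abc-iut cell; seat abc-iut-E-t13 (slot T-13, [J-III] §7.5/§7.7; gen 6). PROOF/BRIDGE companion of
slot T-09's SIGNATURE file `Joshi/LocalPeriodRings.lean` (p429989: `PeriodRingTower`, `BEDatum`, `BE := B ⊔ E ⊂ B_dR`,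
`Btilde := B ⊗_{ℚ_p} E`, `btildeToBdR`, the claim-`Prop`s `BELinDisjoint` (Lemma 5.2.3.1), `BtildeSplits` (5.2.5.4)), of
`Joshi/LocalPeriodRingsProofs.lean` (p433275: `toBtilOfSplits` = (5.2.5.5) «under a witness of the claim `BtildeSplits`») and of
`Joshi/LocalPeriodRingsSplitting.lean` (E-t58: (5.2.5.3) under `[IsGalois ℚ_p E_0]`; records that (5.2.5.4) is NOT discharged).
Source: K. Joshi, *Construction of Arithmetic Teichmüller Spaces III*, arXiv:2401.13508**v4** = [J-III] (UNREFEREED «Preliminary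
version for comments»; bib `Joshi2024ATS3`; disputed by `Mochizuki2024JoshiReport`); locators «p.N l.a–b» = PDF page N, lines a–b of
the cell's render `HOME/lit/renders/Joshi-arxiv-2401.13508/pNNNN.txt`. DEFS-FREEZE respected (nothing of p429989 re-declared);
no `def … : Prop`, no new `Prop` fact, no instance, no notation, no axiom, 0 `sorry`. TAKES NO SIDE on [IUTchIII] Cor. 3.12, on
Joshi's claims or on Mochizuki's report on them; typed ≠ proved ≠ endorsed; «derived» = OUR kernel check of OUR typed sentence.

## What print says and what is derived here

* (5.2.5.5) p.40 l.14–16 «the natural diagonal embedding `B_E ↪ B̃_E`» and its use in **(7.5.2.2)** p.59 l.28–41 «using the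
  fact that `B_E ↪ B ⊗_{ℚ_p} E` one has `(⊕_{w∈𝕍^{odd,ss}_p} B_{E′_w})^{ℓ⋇} ↪ B̑_p^{ℓ⋇}`» (slot T-13's named input
  `ATS3.PrimeBundlingDatum.ToTensEInjective`, p429549). In the T-09 typing the diagonal is only available «under a witness `e` of
  the claim (5.2.5.4) `BtildeSplits`» (`toBtilOfSplits e`), and (5.2.5.4) needs, besides Lemma 5.2.3.1, a Frobenius
  compatibility the signature does not carry (E-t58's faithfulness flag).
* HERE: the multiplication map `m : B̃_E = B ⊗_{ℚ_p} E → B_dR`, `b ⊗ e ↦ b·e` (`btildeToBdR`, range `= B_E`, p429989) has a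
  CANONICAL ℚ_p-linear, `B`-linear and multiplicative SECTION `secBE : B_E → B̃_E` as soon as **Lemma 5.2.3.1** (`BELinDisjoint`,
  cited [FF18, Prop. 1.6.9]) holds — built from the separability idempotent `ε ∈ E_0 ⊗_{ℚ_p} E_0` of the finite SEPARABLE
  extension `E_0/ℚ_p` (characteristic `0`; Mathlib `Algebra.FormallyUnramified.elem`, [Iversen, *Generic Local Structure …*,
  Prop. I.2.3]): `secBE x = ε_B · z` for ANY `z` with `m z = x`, where `ε_B ∈ B̃_E` is the image of `ε` under `E_0 → B`
  (§5.2.1, E-t58's `exists_e0ToB`) `⊗ (E_0 ⊂ E)`. PROVED: `m ∘ secBE = (B_E ⊂ B_dR)` (`btildeToBdR_secBE`), hence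
  **`secBE` is injective** (`secBE_injective`) — the (7.5.2.2) input —; `secBE` is additive/ℚ_p-linear (`secBELinear`),
  `B`-linear (`secBE_toBdR_mul`) and multiplicative (`secBE_mul`); `secBE 1 = ε_B` is an idempotent with `m ε_B = 1`; the kernel
  of `m` is the ideal generated by the `E_0`-balancing relations `φ(c) ⊗ 1 − 1 ⊗ c` (`btildeToBdR_eq_zero_iff`, from Lemma
  5.2.3.1: «`B̃_E / (balancing) = B ⊗_{E_0} E ≅ B_E`», the printed (5.2.3.2)), and `ε_B` kills that ideal.
* READING NOTE (located, not adjudicated): under any (5.2.5.4) identification `B̃_E ≅ B_E^{f}` for which `m` is a coordinate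
  projection, `secBE` is the inclusion of THAT ONE factor, not print's diagonal; both are injective ℚ_p-linear right inverses of
  `m`, which is all (7.5.2.2) uses (p.59 l.42–43). What is NOT derived: (5.2.5.4) itself.

bears_on: LADDER-ABC:A2.E. [claim: Joshi2024ATS3, status: disputed]
-/

noncomputable section

open scoped TensorProduct

namespace Summit.ABC.IUTFork.Joshi.ATS3

namespace PeriodRingTower

namespace BEDatum

variable {F B E0 : Type} [Field F] [CommRing B] [Field E0] {Y : Type} {K : Y → Type} [∀ y, Field (K y)]
  {G : Type} [Group G] {D : PeriodRingDatum F B E0 Y K G} {p : ℕ} [Fact p.Prime] [Algebra ℚ_[p] B]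
  {Ω : Type} [Field Ω] [Algebra ℚ_[p] Ω] {T : PeriodRingTower D p Ω} (ℰ : T.BEDatum)

/-! ## 1. The structure maps `E_0 → B` (§5.2.1) and `E_0 ⊂ E` (§5.2.3) as `ℚ_p`-algebra maps -/

/-- **`E_0 → B`** (§5.2.1 p.39 l.9–12 «`B` and `B⁺` are `E_0`-algebras … This remark will be used in what follows»): a CHOICE of
the `ℚ_p`-algebra map of E-t58's `exists_e0ToB` (it is unique, `toBdR` being injective). [claim: Joshi2024ATS3, status: disputed] -/
def e0ToB : ℰ.E0 →ₐ[ℚ_[p]] B := ℰ.exists_e0ToB.choose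

/-- `E_0 → B ↪ B_dR` is the inclusion `E_0 ⊂ B_dR`. [folklore] -/
theorem toBdR_e0ToB (c : ℰ.E0) : T.toBdR (ℰ.e0ToB c) = (c : Ω) := ℰ.exists_e0ToB.choose_spec c

/-- **`E_0 ⊂ E`** (§5.2.3 p.39 l.29–30 «let `E_0 ⊂ E` be its maximal unramified subfield») as a `ℚ_p`-algebra map. [folklore] -/
def e0ToE : ℰ.E0 →ₐ[ℚ_[p]] ℰ.E := IntermediateField.inclusion ℰ.E0_le

/-- … it is the identity on underlying periods. [folklore] -/
@[simp] theorem coe_e0ToE (c : ℰ.E0) : ((ℰ.e0ToE c : ℰ.E) : Ω) = (c : Ω) := rfl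

/-- `E_0/ℚ_p` is finite SEPARABLE (characteristic `0`), hence formally unramified. [folklore] -/
theorem formallyUnramified_E0 : Algebra.FormallyUnramified ℚ_[p] ℰ.E0 := by
  haveI := ℰ.finiteDimensional_E0
  exact Algebra.FormallyUnramified.of_isSeparable ℚ_[p] ℰ.E0

/-- `E_0/ℚ_p` is (essentially) of finite type. [folklore] -/
theorem essFiniteType_E0 : Algebra.EssFiniteType ℚ_[p] ℰ.E0 := by
  haveI := ℰ.finiteDimensional_E0
  infer_instance

/-! ## 2. The separability idempotent `ε ∈ E_0 ⊗_{ℚ_p} E_0` and its image `ε_B ∈ B̃_E = B ⊗_{ℚ_p} E` -/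

/-- For `t ∈ E_0 ⊗_{ℚ_p} E_0`: `t · ε = (μ(t) ⊗ 1) · ε` (`μ` = multiplication), since `ε` kills every `1 ⊗ c − c ⊗ 1`. [folklore] -/
theorem mul_elem_eq (t : ℰ.E0 ⊗[ℚ_[p]] ℰ.E0) :
    haveI := ℰ.formallyUnramified_E0
    haveI := ℰ.essFiniteType_E0
    t * Algebra.FormallyUnramified.elem ℚ_[p] ℰ.E0 =
      (Algebra.TensorProduct.lmul' (S := ℰ.E0) ℚ_[p] t ⊗ₜ[ℚ_[p]] (1 : ℰ.E0)) *
        Algebra.FormallyUnramified.elem ℚ_[p] ℰ.E0 := by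
  haveI := ℰ.formallyUnramified_E0
  haveI := ℰ.essFiniteType_E0
  induction t using TensorProduct.induction_on with
  | zero => simp
  | tmul x y =>
      rw [Algebra.TensorProduct.lmul'_apply_tmul]
      have h : (x ⊗ₜ[ℚ_[p]] y : ℰ.E0 ⊗[ℚ_[p]] ℰ.E0) = (x ⊗ₜ[ℚ_[p]] (1 : ℰ.E0)) * ((1 : ℰ.E0) ⊗ₜ[ℚ_[p]] y) := by
        rw [Algebra.TensorProduct.tmul_mul_tmul, mul_one, one_mul]
      rw [h, mul_assoc, Algebra.FormallyUnramified.one_tmul_mul_elem, ← mul_assoc,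
        Algebra.TensorProduct.tmul_mul_tmul, mul_one]
  | add s t hs ht => rw [add_mul, hs, ht, map_add, TensorProduct.add_tmul, add_mul]

/-- **`ε_B ∈ B̃_E`**: the image of the separability idempotent of `E_0/ℚ_p` under `(E_0 → B) ⊗ (E_0 ⊂ E)`. [folklore] -/
def sepIdem : ℰ.Btilde :=
  haveI := ℰ.formallyUnramified_E0
  haveI := ℰ.essFiniteType_E0
  Algebra.TensorProduct.map ℰ.e0ToB ℰ.e0ToE (Algebra.FormallyUnramified.elem ℚ_[p] ℰ.E0)

/-- `m ∘ ((E_0 → B) ⊗ (E_0 ⊂ E)) = (E_0 ⊂ B_dR) ∘ μ` on `E_0 ⊗_{ℚ_p} E_0`. [folklore] -/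
theorem btildeToBdR_map_eq (t : ℰ.E0 ⊗[ℚ_[p]] ℰ.E0) :
    ℰ.btildeToBdR (Algebra.TensorProduct.map ℰ.e0ToB ℰ.e0ToE t) =
      ((Algebra.TensorProduct.lmul' (S := ℰ.E0) ℚ_[p] t : ℰ.E0) : Ω) := by
  induction t using TensorProduct.induction_on with
  | zero => simp
  | tmul x y =>
      rw [Algebra.TensorProduct.map_tmul, BEDatum.btildeToBdR, Algebra.TensorProduct.productMap_apply_tmul,
        Algebra.TensorProduct.lmul'_apply_tmul, toBdR_e0ToB]
      rfl
  | add s t hs ht => rw [map_add, map_add, hs, ht, map_add]; rfl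

/-- **`m(ε_B) = 1`** (the idempotent maps to `1 ∈ B_E`: `μ(ε) = 1`). [folklore] -/
theorem btildeToBdR_sepIdem : ℰ.btildeToBdR ℰ.sepIdem = 1 := by
  haveI := ℰ.formallyUnramified_E0
  haveI := ℰ.essFiniteType_E0
  unfold sepIdem
  rw [btildeToBdR_map_eq, Algebra.FormallyUnramified.lmul_elem]
  rfl

/-- `ε_B` is an idempotent of `B̃_E`. [folklore] -/
theorem isIdempotentElem_sepIdem : IsIdempotentElem ℰ.sepIdem := by
  haveI := ℰ.formallyUnramified_E0
  haveI := ℰ.essFiniteType_E0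
  unfold sepIdem IsIdempotentElem
  rw [← map_mul, mul_elem_eq, Algebra.FormallyUnramified.lmul_elem]
  change Algebra.TensorProduct.map ℰ.e0ToB ℰ.e0ToE (1 * _) = _
  rw [one_mul]

/-- **`ε_B` kills the `E_0`-balancing relations**: `(1 ⊗ c − φ(c) ⊗ 1) · ε_B = 0` for `c ∈ E_0`. [folklore] -/
theorem sub_mul_sepIdem (c : ℰ.E0) :
    ((1 : B) ⊗ₜ[ℚ_[p]] ℰ.e0ToE c - ℰ.e0ToB c ⊗ₜ[ℚ_[p]] (1 : ℰ.E)) * ℰ.sepIdem = 0 := by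
  haveI := ℰ.formallyUnramified_E0
  haveI := ℰ.essFiniteType_E0
  have h := congrArg (Algebra.TensorProduct.map ℰ.e0ToB ℰ.e0ToE)
    (Algebra.FormallyUnramified.one_tmul_sub_tmul_one_mul_elem (R := ℚ_[p]) (S := ℰ.E0) c)
  rw [map_mul, map_zero, map_sub, Algebra.TensorProduct.map_tmul, Algebra.TensorProduct.map_tmul, map_one,
    map_one] at h
  exact h

/-- Equivalently `(1 ⊗ c) · ε_B = (φ(c) ⊗ 1) · ε_B`. [folklore] -/
theorem one_tmul_mul_sepIdem (c : ℰ.E0) :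
    ((1 : B) ⊗ₜ[ℚ_[p]] ℰ.e0ToE c) * ℰ.sepIdem = (ℰ.e0ToB c ⊗ₜ[ℚ_[p]] (1 : ℰ.E)) * ℰ.sepIdem := by
  rw [← sub_eq_zero, ← sub_mul, sub_mul_sepIdem]

/-! ## 3. The `E_0`-balancing ideal of `B̃_E` and the kernel of `m` (Lemma 5.2.3.1 ⟹ `ker m` = balancing ideal) -/

/-- The ideal of `B̃_E = B ⊗_{ℚ_p} E` generated by the `E_0`-balancing relations `1 ⊗ c − φ(c) ⊗ 1`, `c ∈ E_0` — so that
`B̃_E / balanceIdeal = B ⊗_{E_0} E`, the ring of Lemma 5.2.3.1 (5.2.3.2). [claim: Joshi2024ATS3, status: disputed] -/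
def balanceIdeal : Ideal ℰ.Btilde :=
  Ideal.span (Set.range fun c : ℰ.E0 => (1 : B) ⊗ₜ[ℚ_[p]] ℰ.e0ToE c - ℰ.e0ToB c ⊗ₜ[ℚ_[p]] (1 : ℰ.E))

/-- `ε_B` kills the balancing ideal. [folklore] -/
theorem mul_sepIdem_eq_zero_of_mem {z : ℰ.Btilde} (hz : z ∈ ℰ.balanceIdeal) : z * ℰ.sepIdem = 0 := by
  induction hz using Submodule.span_induction with
  | mem x hx => obtain ⟨c, rfl⟩ := hx; exact ℰ.sub_mul_sepIdem c
  | zero => exact zero_mul _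
  | add x y _ _ hx hy => rw [add_mul, hx, hy, add_zero]
  | smul r x _ hx => rw [smul_eq_mul, mul_assoc, hx, mul_zero]

/-- `m` kills the balancing ideal (`m(1 ⊗ c) = c = m(φ(c) ⊗ 1)`). [folklore] -/
theorem btildeToBdR_eq_zero_of_mem {z : ℰ.Btilde} (hz : z ∈ ℰ.balanceIdeal) : ℰ.btildeToBdR z = 0 := by
  induction hz using Submodule.span_induction with
  | mem x hx =>
      obtain ⟨c, rfl⟩ := hx
      rw [map_sub, BEDatum.btildeToBdR, Algebra.TensorProduct.productMap_apply_tmul,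
        Algebra.TensorProduct.productMap_apply_tmul, map_one, map_one, one_mul, mul_one, toBdR_e0ToB, sub_eq_zero]
      rfl
  | zero => exact map_zero _
  | add x y _ _ hx hy => rw [map_add, hx, hy, add_zero]
  | smul r x _ hx => rw [smul_eq_mul, map_mul, hx, mul_zero]

/-- `E` as an `E_0`-submodule of `B_dR` (closed under `E_0 ⊂ E`). [folklore] -/
def ESubmoduleE0 : Submodule ℰ.E0 Ω where
  carrier := ℰ.E
  add_mem' := fun ha hb => ℰ.E.add_mem ha hb
  zero_mem' := ℰ.E.zero_mem
  smul_mem' := fun c _ hx => by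
    rw [Algebra.smul_def]
    exact ℰ.E.mul_mem (ℰ.E0_le c.2) hx

/-- Membership in `ESubmoduleE0` is membership in `E`. [folklore] -/
@[simp] theorem mem_ESubmoduleE0 {x : Ω} : x ∈ ℰ.ESubmoduleE0 ↔ x ∈ ℰ.E := Iff.rfl
/-- `E` is a finite `E_0`-module (it is already finite over `ℚ_p ⊂ E_0`). [folklore] -/
theorem finite_ESubmoduleE0 : Module.Finite ℰ.E0 ℰ.ESubmoduleE0 := by
  haveI := ℰ.finiteDimensional
  -- the `ℚ_p`-structure on `ESubmoduleE0` (restricted from `E_0`) is the one of `E`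
  let f : ℰ.E →ₗ[ℚ_[p]] ℰ.ESubmoduleE0 :=
    { toFun := fun e => ⟨(e : Ω), e.2⟩
      map_add' := fun _ _ => rfl
      map_smul' := fun c e => Subtype.ext (by
        change ((c • e : ℰ.E) : Ω) = c • (e : Ω)
        rw [IntermediateField.coe_smul]) }
  have hf : Function.Surjective f := fun x => ⟨⟨x.1, x.2⟩, rfl⟩
  haveI : Module.Finite ℚ_[p] ℰ.ESubmoduleE0 := Module.Finite.of_surjective f hf
  exact Module.Finite.of_restrictScalars_finite ℚ_[p] ℰ.E0 ℰ.ESubmoduleE0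

/-- **Normal form modulo the balancing ideal**: if a finite family `v` of elements of `E` SPANS `E` over `E_0` (through
`E_0 ⊂ E`), every `z ∈ B ⊗_{ℚ_p} E` is congruent modulo `balanceIdeal` to some `∑_i b_i ⊗ v_i` («`B ⊗_{E_0} E` is generated
over `B` by an `E_0`-basis of `E`»). [folklore] -/
theorem exists_sum_tmul_sub_mem {ι : Type} [Fintype ι] (v : ι → ℰ.E)
    (hv : ∀ e : ℰ.E, ∃ c : ι → ℰ.E0, e = ∑ i, v i * ℰ.e0ToE (c i)) (z : ℰ.Btilde) :
    ∃ b : ι → B, z - ∑ i, b i ⊗ₜ[ℚ_[p]] v i ∈ ℰ.balanceIdeal := by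
  induction z using TensorProduct.induction_on with
  | zero => exact ⟨0, by simp⟩
  | tmul b e =>
      -- expand `e = ∑ v_i c_i` over `E_0` and move each `c_i` across the tensor sign modulo the balancing ideal
      obtain ⟨c, hc⟩ := hv e
      refine ⟨fun i => b * ℰ.e0ToB (c i), ?_⟩
      have hrw : b ⊗ₜ[ℚ_[p]] e - ∑ i, (b * ℰ.e0ToB (c i)) ⊗ₜ[ℚ_[p]] v i
          = ∑ i, (b ⊗ₜ[ℚ_[p]] v i) *
              ((1 : B) ⊗ₜ[ℚ_[p]] ℰ.e0ToE (c i) - ℰ.e0ToB (c i) ⊗ₜ[ℚ_[p]] (1 : ℰ.E)) := by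
        rw [hc, TensorProduct.tmul_sum, ← Finset.sum_sub_distrib]
        refine Finset.sum_congr rfl fun i _ => ?_
        rw [mul_sub, Algebra.TensorProduct.tmul_mul_tmul, Algebra.TensorProduct.tmul_mul_tmul, mul_one, mul_one]
      rw [hrw]
      exact Ideal.sum_mem _ fun i _ => Ideal.mul_mem_left _ _ (Ideal.subset_span ⟨c i, rfl⟩)
  | add x y hx hy =>
      obtain ⟨bx, hbx⟩ := hx
      obtain ⟨by_, hby⟩ := hy
      refine ⟨bx + by_, ?_⟩
      have hrw : x + y - ∑ i, (bx + by_) i ⊗ₜ[ℚ_[p]] v i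
          = (x - ∑ i, bx i ⊗ₜ[ℚ_[p]] v i) + (y - ∑ i, by_ i ⊗ₜ[ℚ_[p]] v i) := by
        simp only [Pi.add_apply, TensorProduct.add_tmul, Finset.sum_add_distrib]
        abel
      rw [hrw]
      exact Ideal.add_mem _ hbx hby

/-- An `E_0`-basis of `E` (inside `B_dR`): an `E_0`-linearly independent finite family in `E` spanning `E` over `E_0 ⊂ E`. [folklore] -/
theorem exists_basis_E0 : ∃ (n : ℕ) (v : Fin n → ℰ.E), LinearIndependent ℰ.E0 (fun i => (v i : Ω)) ∧
    ∀ e : ℰ.E, ∃ c : Fin n → ℰ.E0, e = ∑ i, v i * ℰ.e0ToE (c i) := by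
  haveI := ℰ.finite_ESubmoduleE0
  haveI : Module.Free ℰ.E0 ℰ.ESubmoduleE0 := Module.Free.of_divisionRing ℰ.E0 ℰ.ESubmoduleE0
  let w := Module.finBasis ℰ.E0 ℰ.ESubmoduleE0
  refine ⟨_, fun i => ⟨(w i : Ω), (w i).2⟩, ?_, fun e => ⟨fun i => w.repr ⟨(e : Ω), e.2⟩ i, Subtype.ext ?_⟩⟩
  · exact w.linearIndependent.map' ℰ.ESubmoduleE0.subtype (Submodule.ker_subtype _)
  · have h := congrArg (fun y : ℰ.ESubmoduleE0 => (y : Ω)) (w.sum_repr ⟨(e : Ω), e.2⟩)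
    simp only [Submodule.coe_sum, Submodule.coe_smul_of_tower, IntermediateField.smul_def, smul_eq_mul] at h
    rw [IntermediateField.coe_sum]
    simp only [MulMemClass.coe_mul, coe_e0ToE]
    exact h.symm.trans (Finset.sum_congr rfl fun i _ => mul_comm _ _)

/-- **Lemma 5.2.3.1 ⟹ `ker m ⊆ balanceIdeal`** («`B ⊗_{E_0} E ≃ B_E`», (5.2.3.2), read through `m`): if `B` and `E` are
linearly disjoint over `E_0` in `B_dR`, an element of `B ⊗_{ℚ_p} E` killed by `m` lies in the balancing ideal. [folklore] -/
theorem mem_balanceIdeal_of_btildeToBdR_eq_zero (h : ℰ.BELinDisjoint) {z : ℰ.Btilde} (hz : ℰ.btildeToBdR z = 0) :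
    z ∈ ℰ.balanceIdeal := by
  obtain ⟨n, v, hli, hspan⟩ := ℰ.exists_basis_E0
  obtain ⟨b, hb⟩ := ℰ.exists_sum_tmul_sub_mem v hspan z
  -- `m` of the normal form vanishes, so Lemma 5.2.3.1 kills every coefficient
  have hsum : ∑ i, T.toBdR (b i) * (v i : Ω) = 0 := by
    have h1 := ℰ.btildeToBdR_eq_zero_of_mem hb
    rw [map_sub, hz, zero_sub, neg_eq_zero, map_sum] at h1
    rw [← h1]
    refine Finset.sum_congr rfl fun i _ => ?_
    rw [BEDatum.btildeToBdR, Algebra.TensorProduct.productMap_apply_tmul]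
    rfl
  have hzero : ∀ i, b i = 0 := h n (fun i => (v i : Ω)) (fun i => (v i).2) hli b hsum
  have hb' : z - ∑ i, b i ⊗ₜ[ℚ_[p]] v i = z := by simp [hzero]
  rwa [hb'] at hb

/-- Hence, under Lemma 5.2.3.1, **`ker m = balanceIdeal`**. [folklore] -/
theorem btildeToBdR_eq_zero_iff (h : ℰ.BELinDisjoint) (z : ℰ.Btilde) :
    ℰ.btildeToBdR z = 0 ↔ z ∈ ℰ.balanceIdeal :=
  ⟨ℰ.mem_balanceIdeal_of_btildeToBdR_eq_zero h, ℰ.btildeToBdR_eq_zero_of_mem⟩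

/-- … and `ε_B · z` depends only on `m z`. [folklore] -/
theorem sepIdem_mul_eq_of_btildeToBdR_eq (h : ℰ.BELinDisjoint) {z z' : ℰ.Btilde}
    (hzz : ℰ.btildeToBdR z = ℰ.btildeToBdR z') : ℰ.sepIdem * z = ℰ.sepIdem * z' := by
  have h0 : (z - z') * ℰ.sepIdem = 0 :=
    ℰ.mul_sepIdem_eq_zero_of_mem (ℰ.mem_balanceIdeal_of_btildeToBdR_eq_zero h (by rw [map_sub, hzz, sub_self]))
  calc ℰ.sepIdem * z = ℰ.sepIdem * z' + (z - z') * ℰ.sepIdem := by ring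
    _ = ℰ.sepIdem * z' := by rw [h0, add_zero]

/-! ## 4. The section `secBE : B_E → B̃_E` of `m` — (5.2.5.5) / the (7.5.2.2) input, from Lemma 5.2.3.1 alone -/

/-- Every `x ∈ B_E` has a preimage under `m` (`range m = B_E`, p429989 `btildeToBdR_range`). [folklore] -/
theorem exists_btildeToBdR_eq (x : T.BE ℰ.E) : ∃ z : ℰ.Btilde, ℰ.btildeToBdR z = (x : Ω) := by
  have hx : (x : Ω) ∈ ℰ.btildeToBdR.range := by rw [ℰ.btildeToBdR_range]; exact x.2
  exact hx

/-- **`secBE : B_E → B̃_E`, `x ↦ ε_B · z` for any `z` with `m z = x`** — the canonical candidate section of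
`m : B̃_E ↠ B_E` attached to the separability idempotent (as a bare function; its linearity needs Lemma 5.2.3.1, below).
[claim: Joshi2024ATS3, status: disputed] -/
def secBE (x : T.BE ℰ.E) : ℰ.Btilde := ℰ.sepIdem * (ℰ.exists_btildeToBdR_eq x).choose

/-- **`m ∘ secBE = (B_E ⊂ B_dR)`** — `secBE` is a section of the multiplication map (unconditionally). [folklore] -/
theorem btildeToBdR_secBE (x : T.BE ℰ.E) : ℰ.btildeToBdR (ℰ.secBE x) = (x : Ω) := by
  unfold secBE
  rw [map_mul, btildeToBdR_sepIdem, one_mul]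
  exact (ℰ.exists_btildeToBdR_eq x).choose_spec

/-- **`secBE` is injective** — the content of (5.2.5.5) / (7.5.2.2) «`B_E ↪ B ⊗_{ℚ_p} E`». [folklore] -/
theorem secBE_injective : Function.Injective ℰ.secBE := fun x y hxy =>
  Subtype.ext (by rw [← ℰ.btildeToBdR_secBE x, ← ℰ.btildeToBdR_secBE y, hxy])

/-- Under Lemma 5.2.3.1 the choice of preimage is immaterial: `secBE (m z) = ε_B · z`. [folklore] -/
theorem secBE_eq_sepIdem_mul (h : ℰ.BELinDisjoint) {x : T.BE ℰ.E} {z : ℰ.Btilde} (hz : ℰ.btildeToBdR z = (x : Ω)) :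
    ℰ.secBE x = ℰ.sepIdem * z :=
  ℰ.sepIdem_mul_eq_of_btildeToBdR_eq h (by rw [(ℰ.exists_btildeToBdR_eq x).choose_spec, hz])

/-- `secBE` on the generators: `secBE (b·e) = ε_B · (b ⊗ e)` for `b ∈ B`, `e ∈ E`. [folklore] -/
theorem secBE_toBdR_mul_coe (h : ℰ.BELinDisjoint) (b : B) (e : ℰ.E) :
    ℰ.secBE ⟨T.toBdR b * (e : Ω), (T.BE ℰ.E).mul_mem (T.toBdR_mem_BE ℰ.E b) (T.mem_BE_of_mem ℰ.E e.2)⟩ =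
      ℰ.sepIdem * (b ⊗ₜ[ℚ_[p]] e) :=
  ℰ.secBE_eq_sepIdem_mul h (by rw [BEDatum.btildeToBdR, Algebra.TensorProduct.productMap_apply_tmul]; rfl)

/-- `secBE 1 = ε_B`. [folklore] -/
theorem secBE_one (h : ℰ.BELinDisjoint) : ℰ.secBE 1 = ℰ.sepIdem := by
  have h1 : ℰ.btildeToBdR 1 = ((1 : T.BE ℰ.E) : Ω) := by
    rw [Algebra.TensorProduct.one_def, BEDatum.btildeToBdR, Algebra.TensorProduct.productMap_apply_tmul,
      _root_.map_one T.toBdR, one_mul]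
    rfl
  rw [ℰ.secBE_eq_sepIdem_mul h h1, mul_one]

/-- `secBE` is additive (Lemma 5.2.3.1). [folklore] -/
theorem secBE_add (h : ℰ.BELinDisjoint) (x y : T.BE ℰ.E) : ℰ.secBE (x + y) = ℰ.secBE x + ℰ.secBE y := by
  obtain ⟨zx, hzx⟩ := ℰ.exists_btildeToBdR_eq x
  obtain ⟨zy, hzy⟩ := ℰ.exists_btildeToBdR_eq y
  rw [ℰ.secBE_eq_sepIdem_mul h hzx, ℰ.secBE_eq_sepIdem_mul h hzy,
    ℰ.secBE_eq_sepIdem_mul h (z := zx + zy) (by rw [map_add, hzx, hzy]; rfl), mul_add]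

/-- `secBE` commutes with `ℚ_p`-scalars (Lemma 5.2.3.1). [folklore] -/
theorem secBE_smul (h : ℰ.BELinDisjoint) (c : ℚ_[p]) (x : T.BE ℰ.E) : ℰ.secBE (c • x) = c • ℰ.secBE x := by
  obtain ⟨zx, hzx⟩ := ℰ.exists_btildeToBdR_eq x
  rw [ℰ.secBE_eq_sepIdem_mul h hzx,
    ℰ.secBE_eq_sepIdem_mul h (z := c • zx) (by rw [map_smul, hzx]; rfl), mul_smul_comm]

/-- **`secBE` is multiplicative** (Lemma 5.2.3.1; `ε_B` idempotent): `B_E ≅ ε_B · B̃_E` as (non-unital) rings. [folklore] -/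
theorem secBE_mul (h : ℰ.BELinDisjoint) (x y : T.BE ℰ.E) : ℰ.secBE (x * y) = ℰ.secBE x * ℰ.secBE y := by
  obtain ⟨zx, hzx⟩ := ℰ.exists_btildeToBdR_eq x
  obtain ⟨zy, hzy⟩ := ℰ.exists_btildeToBdR_eq y
  rw [ℰ.secBE_eq_sepIdem_mul h hzx, ℰ.secBE_eq_sepIdem_mul h hzy,
    ℰ.secBE_eq_sepIdem_mul h (z := zx * zy) (by rw [map_mul, hzx, hzy]; rfl)]
  calc ℰ.sepIdem * (zx * zy) = (ℰ.sepIdem * ℰ.sepIdem) * (zx * zy) := by rw [ℰ.isIdempotentElem_sepIdem.eq]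
    _ = ℰ.sepIdem * zx * (ℰ.sepIdem * zy) := by ring

/-- **`secBE` is `B`-linear** (Lemma 5.2.3.1): `secBE (b·x) = (b ⊗ 1) · secBE x`. [folklore] -/
theorem secBE_toBdR_mul (h : ℰ.BELinDisjoint) (b : B) (x : T.BE ℰ.E) :
    ℰ.secBE (⟨T.toBdR b, T.toBdR_mem_BE ℰ.E b⟩ * x) = (b ⊗ₜ[ℚ_[p]] (1 : ℰ.E)) * ℰ.secBE x := by
  obtain ⟨zx, hzx⟩ := ℰ.exists_btildeToBdR_eq x
  rw [ℰ.secBE_eq_sepIdem_mul h hzx, ℰ.secBE_eq_sepIdem_mul h (z := b ⊗ₜ[ℚ_[p]] (1 : ℰ.E) * zx)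
    (by rw [map_mul, hzx, BEDatum.btildeToBdR, Algebra.TensorProduct.productMap_apply_tmul, map_one, mul_one]; rfl)]
  ring

/-- **`secBE` is `E`-linear** (Lemma 5.2.3.1): `secBE (e·x) = (1 ⊗ e) · secBE x`. [folklore] -/
theorem secBE_coe_mul (h : ℰ.BELinDisjoint) (e : ℰ.E) (x : T.BE ℰ.E) :
    ℰ.secBE (⟨(e : Ω), T.mem_BE_of_mem ℰ.E e.2⟩ * x) = ((1 : B) ⊗ₜ[ℚ_[p]] e) * ℰ.secBE x := by
  obtain ⟨zx, hzx⟩ := ℰ.exists_btildeToBdR_eq x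
  rw [ℰ.secBE_eq_sepIdem_mul h hzx, ℰ.secBE_eq_sepIdem_mul h (z := (1 : B) ⊗ₜ[ℚ_[p]] e * zx)
    (by rw [map_mul, hzx, BEDatum.btildeToBdR, Algebra.TensorProduct.productMap_apply_tmul, map_one, one_mul]; rfl)]
  ring

/-- **(5.2.5.5) / the (7.5.2.2) input as a `ℚ_p`-LINEAR injection `B_E →ₗ[ℚ_p] B ⊗_{ℚ_p} E`** (Lemma 5.2.3.1): `secBE`
packaged as a linear map — the shape of slot T-13's field `ATS3.PrimeBundlingDatum.toTensE`. [claim: Joshi2024ATS3, status: disputed] -/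
def secBELinear (h : ℰ.BELinDisjoint) : T.BE ℰ.E →ₗ[ℚ_[p]] ℰ.Btilde where
  toFun := ℰ.secBE
  map_add' := ℰ.secBE_add h
  map_smul' := ℰ.secBE_smul h

/-- `secBELinear` is `secBE`. [folklore] -/
@[simp] theorem secBELinear_apply (h : ℰ.BELinDisjoint) (x : T.BE ℰ.E) : ℰ.secBELinear h x = ℰ.secBE x := rfl
/-- **`secBELinear` is injective** — «`B_E ↪ B ⊗_{ℚ_p} E`» (7.5.2.2), DERIVED from Lemma 5.2.3.1 with no (5.2.5.4) witness.
[folklore] -/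
theorem secBELinear_injective (h : ℰ.BELinDisjoint) : Function.Injective (ℰ.secBELinear h) := ℰ.secBE_injective

/-- **The range of `secBE` is the ideal factor `ε_B · B̃_E`** (Lemma 5.2.3.1): `B_E` sits in `B̃_E` as the direct factor cut out by
the idempotent `ε_B` (`B̃_E = ε_B B̃_E ⊕ (1 − ε_B) B̃_E`) — the one-factor half of (5.2.5.4). [folklore] -/
theorem range_secBE (h : ℰ.BELinDisjoint) : Set.range ℰ.secBE = (Ideal.span {ℰ.sepIdem} : Set ℰ.Btilde) := by
  ext z
  constructor
  · rintro ⟨x, rfl⟩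
    exact Ideal.mem_span_singleton'.2
      ⟨(ℰ.exists_btildeToBdR_eq x).choose, mul_comm (ℰ.exists_btildeToBdR_eq x).choose ℰ.sepIdem⟩
  · intro hz
    obtain ⟨a, rfl⟩ := Ideal.mem_span_singleton'.1 hz
    refine ⟨⟨ℰ.btildeToBdR (a * ℰ.sepIdem), by rw [← ℰ.btildeToBdR_range]; exact ⟨_, rfl⟩⟩, ?_⟩
    rw [ℰ.secBE_eq_sepIdem_mul h (z := a * ℰ.sepIdem) rfl]
    calc ℰ.sepIdem * (a * ℰ.sepIdem) = a * (ℰ.sepIdem * ℰ.sepIdem) := by ring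
      _ = a * ℰ.sepIdem := by rw [ℰ.isIdempotentElem_sepIdem.eq]

end BEDatum

end PeriodRingTower

end Summit.ABC.IUTFork.Joshi.ATS3

end
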